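import Mathlib.Analysis.Meromorphic.NormalForm
import Literature.NumberTheory.GaloisRepresentations.ArtinLFunctionRegularReGeOneProofs
import Literature.NumberTheory.GaloisRepresentations.ArtinLFunctionContinuationFE
import Literature.NumberTheory.GaloisRepresentations.FramedRepDualIrreducible
import HarnessLib

/-!
# Artin L-functions without trivial constituent are regular off the critical strip, given
# Artin's functional equation (pure proofs)

Companion to `Literature.NumberTheory.GaloisRepresentations.ArtinLFunctionRegularReGeOneProofs`
(Heilbronn: `L(s, ρ)` with `V^{Γ_K} = 0` is regular and non-zero on `Re s ≥ 1`) and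
`Literature.NumberTheory.GaloisRepresentations.ArtinLFunctionContinuationFE` (the archimedean
factor `A(ρ)^{s/2} γ(ρ, s)` and its entire inverse).  It proves the remark with which
A. R. Booker opens the proof of his Theorem (*Poles of Artin L-functions and the strong Artin
conjecture*, Ann. of Math. 158 (2003), p. 1091):

> "It is known, by nonvanishing results for Hecke L-functions [10], that `L(s, ρ ⊗ χ)` is
> holomorphic in `Re(s) ≥ 1`, and by the functional equation, in `Re(s) ≤ 0`."

in the form consumed by Booker's Lemma 1 (p. 1092: "poles possible only in the strip
`0 < Re(s) < 1`"), for an arbitrary pair of Artin representations `ρ`, `ρ'` of a number field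
`K` in place of `ρ ⊗ χ` and its contragredient:

* `ArtinRep.exists_meromorphicOn_eq_artinLFunction_analyticAt_off_strip` (**main, proved**): if
  `ρ` and `ρ'` satisfy Artin's functional equation (`ArtinRep.SatisfiesFunctionalEquation ρ ρ'`:
  meromorphic `Λ, Λ'` on `ℂ` continuing `Λ(s, ρ) = A(ρ)^{s/2} γ(ρ, s) L(s, ρ)` and `Λ(s, ρ')`
  from `Re s > 1`, with `Λ(1 - s) = W Λ'(s)`; the clause of the named fact
  `Automorphic.artin_functional_equation` with `ρ' = ρ^∨`, Neukirch VII (12.6)) and neither `ρ`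
  nor `ρ'` has a non-zero invariant vector (`V^{Γ_K} = 0`, `V'^{Γ_K} = 0`), then there is
  `D : ℂ → ℂ`, meromorphic on `ℂ`, ANALYTIC at every `s` with `Re s ≤ 0` or `Re s ≥ 1`, non-zero
  at every `s` with `Re s ≥ 1`, and equal to `L(s, ρ)` for `Re s > 1`;
* `FramedArtinRep.exists_meromorphicOn_eq_artinLFunction_analyticAt_off_strip_of_isIrreducible` —
  the case of an IRREDUCIBLE framed `σ : Γ_K → GL_n(ℂ)`, `n ≥ 2`, satisfying the functional
  equation against its contragredient `σ^∨` (`FramedRep.dual`): `σ` and `σ^∨` (irreducible with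
  `σ`, `FramedRep.isIrreducible_toContinuousRep_dual`) have no invariants (Serre, *Linear
  Representations of Finite Groups*, §2.3; the elementary lemma
  `Automorphic.invariants_eq_bot_of_isIrreducible_of_one_lt_finrank` of
  `Automorphic/BookerStrongArtinReduction`, re-proved privately here so that this file does not
  import the automorphic cone).  This is the shape of Booker's twists `ρ ⊗ χ`.

**Proof.**  Let `F`, `F'` be Heilbronn's continuations of `L(s, ρ)`, `L(s, ρ')`
(`exists_meromorphic_eq_artinLFunction_of_invariants_eq_bot`: meromorphic on `ℂ`, analytic and
non-zero on `Re s ≥ 1`), `Φ(s) = A(ρ)^{s/2} γ(ρ, s)`, `Φ'` likewise for `ρ'` (holomorphic on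
`Re s > 0`), and `γinv` the entire function with `Φ γinv = 1` on `Re s > 0`
(`ArtinRep.exists_differentiable_mul_completedFactor_eq_one`).  Put `f = γinv · Λ`, meromorphic
on `ℂ`.  By the identity principle on the half-plane `Re s > 0`
(`LFunctions.eventuallyEq_zero_of_eqOn_halfPlane`), `Λ = Φ F` and `Λ' = Φ' F'` on punctured
neighbourhoods of each of its points, since both sides agree on `Re s > 1`.  Hence near a point
`z` with `Re z ≥ 1`, `f` agrees puncturedly with the analytic `γinv Φ F`, and near a point `z`
with `Re z ≤ 0`, by the functional equation `Λ(s) = W Λ'(1 - s)` and `Re (1 - z) ≥ 1`, with the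
analytic `s ↦ γinv(s) W Φ'(1 - s) F'(1 - s)`.  So `f` has non-negative meromorphic order off the
open strip, and its normal form `D = toMeromorphicNFOn f ℂ` (Mathlib) is analytic there; on
`Re z ≥ 1` moreover `D(z) = γinv(z) Φ(z) F(z) = F(z) ≠ 0`, which is `L(z, ρ)` when `Re z > 1`.
Pointwise values of a Mathlib-meromorphic function off `Re s > 1` are not determined by its
germs, whence the passage to the normal form (same device as
`Automorphic.hasEntireContinuation_completedArtinLFunction_of_hasEntireContinuation`).

No definition and no named fact is introduced (D-0026); theorems only.  Base field `K : Type`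
(universe `0`), forced by `ArtinLFunctionRegularReGeOneProofs`.

## References

* A. R. Booker, *Poles of Artin L-functions and the strong Artin conjecture*, Ann. of Math. (2)
  158 (2003), 1089–1098: p. 1091 and Lemma 1, p. 1092. [Booker2003]
* H. Heilbronn, *Zeta-functions and L-functions*, Ch. VIII of Cassels–Fröhlich (1967), §3,
  Thm. 7 and the two paragraphs following it. [HeilbronnZetaL1967]
* J. Neukirch, *Algebraic Number Theory* (1999), VII §12, (12.5)–(12.6). [NeukirchANT1999]
* J.-P. Serre, *Linear Representations of Finite Groups* (1977), §2.3.
  [SerreLinearRepresentations1977]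

## Mathlib / tree search

Mathlib (this pin): `toMeromorphicNFOn`, `meromorphicNFOn_toMeromorphicNFOn`,
`meromorphicOrderAt_toMeromorphicNFOn`, `MeromorphicOn.toMeromorphicNFOn_eq_self_on_nhdsNE`,
`MeromorphicNFAt.meromorphicOrderAt_nonneg_iff_analyticAt`, `meromorphicOrderAt_congr`,
`Filter.EventuallyEq.comp_tendsto`.  Tree (`lean search 'off_strip|analyticAt_off|RegularOffStrip'`):
nothing; the nearest results are `exists_meromorphic_eq_artinLFunction_of_invariants_eq_bot`
(`Re s ≥ 1` only, no functional equation) and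
`Automorphic.hasEntireContinuation_completedArtinLFunction_of_hasEntireContinuation` (the
converse direction: `L` entire ⇒ `Λ` entire).
-/

noncomputable section

open scoped Topology
open Filter Complex Set
open Literature.NumberTheory.LFunctions

namespace Literature.NumberTheory.GaloisRepresentations

universe w w'

namespace ArtinRep

variable {K : Type} [Field K] [NumberField K]
  {V : Type w} [AddCommGroup V] [Module ℂ V] [TopologicalSpace V] [FiniteDimensional ℂ V]
  [IsModuleTopology ℂ V]
  {V' : Type w'} [AddCommGroup V'] [Module ℂ V'] [TopologicalSpace V'] [FiniteDimensional ℂ V']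
  [IsModuleTopology ℂ V']

omit [IsModuleTopology ℂ V] in
/-- **Identity principle for a witness of the functional equation on `Re s > 0`.**  If `Λ` is
meromorphic on `ℂ` and agrees with `Λ(s, ρ) = A(ρ)^{s/2} γ(ρ, s) L(s, ρ)` on `Re s > 1`, and `F`
is meromorphic on `ℂ` and agrees with `L(s, ρ)` on `Re s > 1`, then
`Λ = A(ρ)^{s/2} γ(ρ, s) F` on a punctured neighbourhood of every point of `Re s > 0` (both sides
are meromorphic on this preconnected half-plane, `γ(ρ, ·)` being holomorphic there,
`ArtinRep.exists_differentiable_mul_completedFactor_eq_one`; then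
`LFunctions.eventuallyEq_zero_of_eqOn_halfPlane`). [folklore] -/
theorem eventuallyEq_completedFactor_mul_of_eqOn (ρ : ArtinRep K V) {Λ F : ℂ → ℂ}
    (hΛ : ∀ z : ℂ, MeromorphicAt Λ z)
    (hΛL : ∀ s : ℂ, 1 < s.re → Λ s = completedArtinLFunction ρ s)
    (hF : ∀ z : ℂ, MeromorphicAt F z) (hFL : ∀ s : ℂ, 1 < s.re → F s = artinLFunction ρ s)
    {z : ℂ} (hz : 0 < z.re) :
    Λ =ᶠ[𝓝[≠] z] fun s => (ρ.artinConductorNorm : ℂ) ^ (s / 2) * ρ.gammaFactor s * F s := by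
  obtain ⟨hΦd, -⟩ := ρ.exists_differentiable_mul_completedFactor_eq_one
  have hopen0 : IsOpen {s : ℂ | 0 < s.re} := isOpen_lt continuous_const continuous_re
  have hΦan : AnalyticOnNhd ℂ
      (fun s : ℂ => (ρ.artinConductorNorm : ℂ) ^ (s / 2) * ρ.gammaFactor s) {s : ℂ | 0 < s.re} :=
    hΦd.analyticOnNhd hopen0
  have hN : MeromorphicOn
      (fun s => Λ s - (ρ.artinConductorNorm : ℂ) ^ (s / 2) * ρ.gammaFactor s * F s)
      {s : ℂ | 0 < s.re} := fun x hx =>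
    (hΛ x).sub ((hΦan x hx).meromorphicAt.mul (hF x))
  have h0 : ∀ s : ℂ, 1 < s.re →
      Λ s - (ρ.artinConductorNorm : ℂ) ^ (s / 2) * ρ.gammaFactor s * F s = 0 := fun s hs => by
    rw [hΛL s hs, hFL s hs, completedArtinLFunction, sub_self]
  filter_upwards [eventuallyEq_zero_of_eqOn_halfPlane hN h0 hz] with w hw
  exact sub_eq_zero.1 hw

/-- **Artin L-functions without trivial constituent are regular off the critical strip, given
the functional equation** (Booker 2003, p. 1091: "`L(s, ρ ⊗ χ)` is holomorphic in `Re(s) ≥ 1`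
[Hecke non-vanishing], and by the functional equation, in `Re(s) ≤ 0`"; Lemma 1, p. 1092:
"poles possible only in the strip `0 < Re(s) < 1`").  Let the Artin representations `ρ`, `ρ'` of
the number field `K` satisfy Artin's functional equation (`ρ.SatisfiesFunctionalEquation ρ'`,
Neukirch VII (12.6) with `ρ' = ρ^∨`) and have no non-zero invariants (`V^{Γ_K} = 0`,
`V'^{Γ_K} = 0`).  Then `L(s, ρ)` has a continuation `D`, meromorphic on `ℂ`, analytic at every
`s` with `Re s ≤ 0` or `Re s ≥ 1`, non-zero at every `s` with `Re s ≥ 1`, and equal to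
`L(s, ρ)` (`artinLFunction ρ s`) for `Re s > 1`.  Proof: with Heilbronn's continuations `F`,
`F'` of `L(s, ρ)`, `L(s, ρ')` (`exists_meromorphic_eq_artinLFunction_of_invariants_eq_bot`,
analytic and non-zero on `Re s ≥ 1`) and the entire inverse `γinv` of `A(ρ)^{s/2} γ(ρ, s)` on
`Re s > 0` (`exists_differentiable_mul_completedFactor_eq_one`), the meromorphic function
`γinv · Λ` agrees puncturedly with the analytic `γinv A^{s/2} γ F` near points of `Re s ≥ 1`
(`eventuallyEq_completedFactor_mul_of_eqOn`) and, through `Λ(s) = W Λ'(1 - s)`, with the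
analytic `γinv(s) W A'^{(1-s)/2} γ'(1 - s) F'(1 - s)` near points of `Re s ≤ 0`; its normal form
(`toMeromorphicNFOn`) is the required `D`. [cite: Booker2003, p. 1091 and Lemma 1 p. 1092]
[cite: NeukirchANT1999, VII §12, Thm. (12.6)]
[cite: HeilbronnZetaL1967, Ch. VIII §3, Thm. 7 and the two paragraphs following it] -/
theorem exists_meromorphicOn_eq_artinLFunction_analyticAt_off_strip {ρ : ArtinRep K V}
    {ρ' : ArtinRep K V'} (hFE : ρ.SatisfiesFunctionalEquation ρ') (hρ : ρ.invariants = ⊥)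
    (hρ' : ρ'.invariants = ⊥) :
    ∃ D : ℂ → ℂ, MeromorphicOn D Set.univ ∧
      (∀ s : ℂ, s.re ≤ 0 ∨ 1 ≤ s.re → AnalyticAt ℂ D s) ∧
      (∀ s : ℂ, 1 ≤ s.re → D s ≠ 0) ∧
      ∀ s : ℂ, 1 < s.re → D s = artinLFunction ρ s := by
  obtain ⟨F, hFm, hFa, hFL⟩ := exists_meromorphic_eq_artinLFunction_of_invariants_eq_bot ρ hρ
  obtain ⟨F', hF'm, hF'a, hF'L⟩ :=
    exists_meromorphic_eq_artinLFunction_of_invariants_eq_bot ρ' hρ'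
  obtain ⟨Λ, Λ', hΛ, hΛ', hagree, W, -, hW⟩ := hFE
  obtain ⟨hΦd, γinv, hγinv, hΦinv⟩ := ρ.exists_differentiable_mul_completedFactor_eq_one
  obtain ⟨hΦ'd, -⟩ := ρ'.exists_differentiable_mul_completedFactor_eq_one
  set Φ : ℂ → ℂ := fun s => (ρ.artinConductorNorm : ℂ) ^ (s / 2) * ρ.gammaFactor s with hΦ
  set Φ' : ℂ → ℂ := fun s => (ρ'.artinConductorNorm : ℂ) ^ (s / 2) * ρ'.gammaFactor s with hΦ'
  have hopen0 : IsOpen {s : ℂ | 0 < s.re} := isOpen_lt continuous_const continuous_re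
  have hΦat : ∀ z : ℂ, 0 < z.re → AnalyticAt ℂ Φ z := fun z hz =>
    hΦd.analyticOnNhd hopen0 z hz
  have hΦ'at : ∀ z : ℂ, 0 < z.re → AnalyticAt ℂ Φ' z := fun z hz =>
    hΦ'd.analyticOnNhd hopen0 z hz
  have hγan : ∀ z : ℂ, AnalyticAt ℂ γinv z := fun z => hγinv.analyticAt z
  -- the functional equation, read at `1 - w`
  have hFE' : ∀ w, Λ w = W * Λ' (1 - w) := fun w => by simpa using hW (1 - w)
  -- punctured agreement of the witnesses with the analytic candidates on `Re s > 0`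
  have hI : ∀ z : ℂ, 0 < z.re → Λ =ᶠ[𝓝[≠] z] fun s => Φ s * F s := fun z hz =>
    ρ.eventuallyEq_completedFactor_mul_of_eqOn hΛ (fun s hs => (hagree s hs).1) hFm hFL hz
  have hI' : ∀ z : ℂ, 0 < z.re → Λ' =ᶠ[𝓝[≠] z] fun s => Φ' s * F' s := fun z hz =>
    ρ'.eventuallyEq_completedFactor_mul_of_eqOn hΛ' (fun s hs => (hagree s hs).2) hF'm hF'L hz
  -- the candidate `f = γinv · Λ` before normalisation
  set f : ℂ → ℂ := fun s => γinv s * Λ s with hf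
  have hfm : ∀ z, MeromorphicAt f z := fun z => (hγan z).meromorphicAt.mul (hΛ z)
  -- right of the strip: `f` agrees puncturedly with the analytic `γinv Φ F`
  have hright : ∀ z : ℂ, 1 ≤ z.re →
      (f =ᶠ[𝓝[≠] z] fun s => γinv s * (Φ s * F s)) ∧
        AnalyticAt ℂ (fun s => γinv s * (Φ s * F s)) z := fun z hz => by
    have hz0 : 0 < z.re := lt_of_lt_of_le zero_lt_one hz
    refine ⟨?_, (hγan z).mul ((hΦat z hz0).mul (hFa z hz).1)⟩
    filter_upwards [hI z hz0] with w hw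
    simp only [hf, hw]
  -- left of the strip: through the functional equation
  have hleft : ∀ z : ℂ, z.re ≤ 0 →
      (f =ᶠ[𝓝[≠] z] fun s => γinv s * (W * (Φ' (1 - s) * F' (1 - s)))) ∧
        AnalyticAt ℂ (fun s => γinv s * (W * (Φ' (1 - s) * F' (1 - s)))) z := fun z hz => by
    have hz1 : 1 ≤ (1 - z).re := by simp only [sub_re, one_re]; linarith
    have hz0 : 0 < (1 - z).re := lt_of_lt_of_le zero_lt_one hz1
    have hsub : AnalyticAt ℂ (fun s : ℂ => 1 - s) z := analyticAt_const.sub analyticAt_id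
    refine ⟨?_, (hγan z).mul (analyticAt_const.mul
      (((hΦ'at (1 - z) hz0).comp hsub).mul ((hF'a (1 - z) hz1).1.comp hsub)))⟩
    have h1 : (fun s => Λ' (1 - s)) =ᶠ[𝓝[≠] z] fun s => Φ' (1 - s) * F' (1 - s) :=
      (hI' (1 - z) hz0).comp_tendsto (tendsto_one_sub_nhdsNE z)
    filter_upwards [h1] with w hw
    simp only [hf, hFE' w]
    rw [show Λ' (1 - w) = Φ' (1 - w) * F' (1 - w) from hw]
  -- so `f` has non-negative order off the open strip
  have hord : ∀ z : ℂ, z.re ≤ 0 ∨ 1 ≤ z.re → 0 ≤ meromorphicOrderAt f z := fun z hz => by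
    rcases hz with hz | hz
    · rw [meromorphicOrderAt_congr (hleft z hz).1]
      exact (hleft z hz).2.meromorphicOrderAt_nonneg
    · rw [meromorphicOrderAt_congr (hright z hz).1]
      exact (hright z hz).2.meromorphicOrderAt_nonneg
  -- normalise
  have hfon : MeromorphicOn f Set.univ := fun z _ => hfm z
  set D : ℂ → ℂ := toMeromorphicNFOn f Set.univ with hD
  have hDNF : MeromorphicNFOn D Set.univ := meromorphicNFOn_toMeromorphicNFOn f Set.univ
  have hDan : ∀ z : ℂ, z.re ≤ 0 ∨ 1 ≤ z.re → AnalyticAt ℂ D z := fun z hz => by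
    have hzU : z ∈ Set.univ := Set.mem_univ z
    apply (hDNF hzU).meromorphicOrderAt_nonneg_iff_analyticAt.1
    rw [meromorphicOrderAt_toMeromorphicNFOn hfon hzU]
    exact hord z hz
  -- the values of `D` right of the strip
  have hDval : ∀ z : ℂ, 1 ≤ z.re → D z = F z := fun z hz => by
    have hz0 : 0 < z.re := lt_of_lt_of_le zero_lt_one hz
    have h1 : D =ᶠ[𝓝[≠] z] fun s => γinv s * (Φ s * F s) :=
      (hfon.toMeromorphicNFOn_eq_self_on_nhdsNE (Set.mem_univ z)).trans (hright z hz).1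
    have h2 : D =ᶠ[𝓝 z] fun s => γinv s * (Φ s * F s) :=
      ((hDan z (Or.inr hz)).continuousAt.eventuallyEq_nhds_iff_eventuallyEq_nhdsNE
        (hright z hz).2.continuousAt).1 h1
    rw [h2.eq_of_nhds]
    calc γinv z * (Φ z * F z) = Φ z * γinv z * F z := by ring
      _ = F z := by rw [show Φ z * γinv z = 1 from hΦinv z hz0, one_mul]
  refine ⟨D, hDNF.meromorphicOn, hDan, fun z hz => ?_, fun z hz => ?_⟩
  · rw [hDval z hz]
    exact (hFa z hz).2
  · rw [hDval z hz.le, hFL z hz]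

end ArtinRep

/-! ### Irreducible framed representations of dimension `≥ 2` -/

section Irreducible

open Module

/-- An irreducible representation of dimension at least `2` has no non-zero invariant vector
(Serre, *Linear Representations of Finite Groups*, §2.3; the tree's
`Automorphic.invariants_eq_bot_of_isIrreducible_of_one_lt_finrank`, re-proved privately to keep
this file inside the Galois-representations topic): the invariants form a subrepresentation, hence
are `0` or everything, and in the latter case every line would be a proper non-zero
subrepresentation. [cite: SerreLinearRepresentations1977, §2.3] -/
private theorem invariants_eq_bot_of_isIrreducible_aux
    {k G V : Type*} [Field k] [Group G] [AddCommGroup V] [Module k V]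
    (ρ : Representation k G V) (hirr : ρ.IsIrreducible) (hV : 1 < Module.finrank k V) :
    ρ.invariants = ⊥ := by
  let I : Subrepresentation ρ := ⟨ρ.invariants, fun g v hv => by
    rw [Representation.mem_invariants] at hv ⊢
    intro h
    rw [hv g, hv h]⟩
  haveI := hirr
  rcases IsSimpleOrder.eq_bot_or_eq_top I with h | h
  · exact congrArg Subrepresentation.toSubmodule h
  · exfalso
    have hall : ∀ (g : G) (v : V), ρ g v = v := fun g v => by
      have hv : v ∈ I.toSubmodule := by
        rw [h]
        exact Submodule.mem_top
      exact (Representation.mem_invariants ρ v).mp hv g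
    have hpos : 0 < Module.finrank k V := zero_lt_one.trans hV
    haveI : Nontrivial V := Module.nontrivial_of_finrank_pos hpos
    obtain ⟨v, hv⟩ := exists_ne (0 : V)
    let L : Subrepresentation ρ := ⟨k ∙ v, fun g w hw => by rw [hall g w]; exact hw⟩
    rcases IsSimpleOrder.eq_bot_or_eq_top L with hL | hL
    · have hbot : (k ∙ v : Submodule k V) = ⊥ := congrArg Subrepresentation.toSubmodule hL
      exact hv (Submodule.span_singleton_eq_bot.mp hbot)
    · have htop : (k ∙ v : Submodule k V) = ⊤ := congrArg Subrepresentation.toSubmodule hL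
      have h1 : Module.finrank k (k ∙ v : Submodule k V) = 1 := finrank_span_singleton hv
      rw [htop, finrank_top] at h1
      omega

variable {K : Type} [Field K] [NumberField K]

/-- **Irreducible Artin L-functions of dimension `≥ 2` are regular off the critical strip, given
the functional equation** (Booker 2003, p. 1091, for the twists `ρ ⊗ χ` of an irreducible
`ρ : Γ_ℚ → GL₂(ℂ)`; Lemma 1, p. 1092).  For an irreducible framed Artin representation
`σ : Γ_K → GL_n(ℂ)`, `n ≥ 2`, satisfying Artin's functional equation against its contragredient
`σ^∨` (`ArtinRep.SatisfiesFunctionalEquation`, the clause of `Automorphic.artin_functional_equation`;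
Neukirch VII (12.6)), there is `D : ℂ → ℂ` meromorphic on `ℂ`, analytic at every `s` with
`Re s ≤ 0` or `Re s ≥ 1`, non-zero on `Re s ≥ 1`, with `D(s) = L(s, σ)` for `Re s > 1`:
`σ^{Γ_K} = 0` and `(σ^∨)^{Γ_K} = 0` (`σ^∨` is irreducible with `σ`,
`FramedRep.isIrreducible_toContinuousRep_dual`; Serre §2.3), so
`ArtinRep.exists_meromorphicOn_eq_artinLFunction_analyticAt_off_strip` applies.
[cite: Booker2003, p. 1091 and Lemma 1 p. 1092] [cite: NeukirchANT1999, VII §12, Thm. (12.6)]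
[cite: SerreLinearRepresentations1977, §2.3] -/
theorem FramedArtinRep.exists_meromorphicOn_eq_artinLFunction_analyticAt_off_strip_of_isIrreducible
    {n : ℕ} (σ : FramedArtinRep K n) (hn : 1 < n) (hirr : σ.toGaloisRep.IsIrreducible)
    (hFE : σ.toArtinRep.SatisfiesFunctionalEquation
      (FramedArtinRep.toArtinRep (FramedRep.dual σ))) :
    ∃ D : ℂ → ℂ, MeromorphicOn D Set.univ ∧
      (∀ s : ℂ, s.re ≤ 0 ∨ 1 ≤ s.re → AnalyticAt ℂ D s) ∧
      (∀ s : ℂ, 1 ≤ s.re → D s ≠ 0) ∧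
      ∀ s : ℂ, 1 < s.re → D s = artinLFunction σ.toArtinRep s :=
  ArtinRep.exists_meromorphicOn_eq_artinLFunction_analyticAt_off_strip hFE
    (invariants_eq_bot_of_isIrreducible_aux _ hirr (by simpa using hn))
    (invariants_eq_bot_of_isIrreducible_aux _
      (FramedRep.isIrreducible_toContinuousRep_dual σ hirr) (by simpa using hn))

end Irreducible

end Literature.NumberTheory.GaloisRepresentations

end
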